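import Mathlib.LinearAlgebra.Dimension.Localization
import Mathlib.LinearAlgebra.FreeModule.PID
import Mathlib.LinearAlgebra.Pi
import Literature.NumberTheory.EllipticCurves.IwasawaOrderOfVanishing
import Literature.NumberTheory.EllipticCurves.KatoRankBoundProofs
import Literature.NumberTheory.EllipticCurves.BSDSelmerPConverseHeegnerMainConjectureProofs
import Literature.NumberTheory.EllipticCurves.IwasawaAlgebraStructureProofs
import Literature.NumberTheory.EllipticCurves.IwasawaOrderKernelRankProofs
import Literature.NumberTheory.EllipticCurves.SelmerCorankControl
import Literature.NumberTheory.EllipticCurves.MordellWeilTheoremProofs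
import HarnessLib

/-!
# Crux `PlecticRankUB` (stmt-BirchSwinnertonDyer-17519), line
# `heegner-leading-form-plectic-certificate` — the HALF-STRENGTH two-max inequality (K2, `k = 1`)

Registered stub K2 (`stub_twoMaxInequality`) of the line asserts, along an anticyclotomic
`ℤ_p`-line `κ` of a CM extension `K/F`, the *parity-free two-max inequality*
`2 · (max(r⁺, r⁻) − rank_Λ X) ≤ ord_T f + δ` for the classical Selmer dual `X = D.X` and every
`f ∈ char_Λ(X_tors)` (derived `p`-adic heights: Howard, Amer. J. Math. 126 (2004) Thm 5.2;
Bertolini–Darmon 1995 Thm 2.18; Nekovář, *Selmer complexes* §11).  Its full strength needs the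
`τ`-action on `D.X`, the `±`-control theorem and the `Λ`-adic Cassels–Tate pairing, none of which
is a tree object (audit `work/stubs/StubTwoMaxInequality-audit.md`, blockers B1–B3).

This file KERNEL-CHECKS the `k = 1` half of K2 — the part that is pure Iwasawa-module algebra
plus the tree's Kummer/control inequality `rank E(K) ≤ rank_{ℤ_p} X/TX`
(`WeierstrassCurve.mordellWeilRank_le_coinvariantsRank`), valid for EVERY number field, EVERY
`ℤ_p`-extension, EVERY topological generator and with no hypothesis on the reduction type:

* `coinvariantsRank_le_finrank_add_order` (T1): for a finitely generated `Λ = ℤ_p⟦T⟧`-module `X`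
  and `f ∈ char_Λ(X_tors)`, `rank_{ℤ_p} X/TX ≤ rank_Λ X + ord_T f` (in `ℕ∞`; `ord_T 0 = ⊤`).
* `mordellWeilRank_sub_finrank_le_order` (T2): for `E/K`, `κ`, `γ`, a finitely generated dual
  datum `D` of `Sel_{p^∞}(E/K_∞)` and `f ∈ char_Λ((D.X)_tors)`:
  `rank E(K) − rank_Λ D.X ≤ ord_T f` (truncated subtraction).
* `max_mordellWeilRank_sub_finrank_le_order` (T3): the specialisation in the shape of K2: for
  `V/F`, `W = V_K`, `r⁺ = rank V(F)`, `r⁻ = rank V(K) − rank V(F)`: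
  `max(r⁺, r⁻) − rank_Λ D.X ≤ ord_T f`, through `max(r⁺, r⁻) ≤ rank V(K)`
  (`mordellWeilRank_le_mordellWeilRank_baseChange`: the rank grows under base change).

## Proof of T1 (Greenberg, LNM 1716, §1 p. 57 and p. 65; Washington §13.2)

Write `ℓ(N) = length_{Λ_𝔭} N_𝔭` for the local length at the height-one prime `𝔭 = (T)`
(`Module.lengthAt … (primeT p)`), so that `rank_{ℤ_p} X/TX = ℓ(X/TX)` for `X` finitely generated
(`lengthAt_coinvariants_eq_coinvariantsRank`).  Along `0 → X_t → X → X'' = X/X_t → 0` the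
functor of `Γ`-coinvariants `N ↦ N/TN` is right exact (`exact_coinvariantsMap`), whence
`ℓ(X/TX) ≤ ℓ(X_t/TX_t) + ℓ(X''/TX'')`.  The torsion part: `ℓ(X_t/TX_t) ≤ ℓ(X_t) ≤ ord_T f`
(`lengthAt_primeT_le_order`: `char(X_t) ⊆ 𝔭^{ℓ(X_t)}`).  The torsion-free part
(`lengthAt_coinvariants_le_finrank_of_isTorsionFree`): `Λ_𝔭` is a discrete valuation ring
(`Module.isPrincipalIdealRing_localization_of_eq_span`), so `X''_𝔭` is free of rank
`ρ = rank_Λ X''` (`Module.free_of_finite_type_torsion_free'`, `IsLocalizedModule.finrank_eq`);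
numerators `y₁, …, y_ρ ∈ X''` of a `Λ_𝔭`-basis span a submodule `L` with `(X''/L)_𝔭 = 0`, and
right exactness along `Λ^ρ → X'' → X''/L → 0` gives `ℓ(X''/TX'') ≤ ℓ(Λ^ρ/TΛ^ρ) + ℓ(X''/L) = ρ`
(`lengthAt_coinvariants_pi`: `Λ/TΛ = Λ/𝔭` has `ℓ = 1`).  Finally `rank_Λ X'' ≤ rank_Λ X`.
In structure-theorem terms this is the count `rank X/TX = ρ + #{j : (f_j) = (T)} ≤ ρ + ∑ a_j`
for `X ∼ Λ^ρ ⊕ ⊕ Λ/(p^{μ_i}) ⊕ ⊕ Λ/(f_j^{a_j})` (Washington Thm 13.12; Greenberg p. 57: "`Y/TY` is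
infinite if and only if `f_j` is an associate of `T`").

## References

* R. Greenberg, *Iwasawa theory for elliptic curves*, LNM 1716 (1999), §1 pp. 57, 63, 65, §3
  Lemma 3.1 [GreenbergLNM1716].
* L. Washington, *Introduction to Cyclotomic Fields*, GTM 83, §13.2, Thm. 13.12 [Washington1997].
* B. Howard, *Derived `p`-adic heights*, Amer. J. Math. 126 (2004), Thm. 5.2, Cor. 5.3 (the full
  two-max inequality, not proved here).
-/

-- `Summit.BirchSwinnertonDyer.BirchSwinnertonDyer` is the mandated summit-side namespace
-- (CONVENTIONS §2); the duplicate component is deliberate.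
set_option linter.dupNamespace false

noncomputable section

open Literature.NumberTheory.EllipticCurves Literature.NumberTheory.EllipticCurves.IwasawaAlgebra

universe u v

namespace Summit.BirchSwinnertonDyer.BirchSwinnertonDyer.Theorems

/-! ### Local lengths of `Γ`-coinvariants at `𝔭 = (T)` -/

/-- **`ℓ_𝔭((Λ^n)_Γ) = n`** at `𝔭 = (T)`: `Γ`-coinvariants commute with finite direct sums
(`lengthAt_coinvariants_prod`) and `ℓ_𝔭(Λ/TΛ) = ℓ_𝔭(Λ/𝔭) = 1` (`lengthAt_coinvariants_self`).
[folklore] -/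
theorem lengthAt_coinvariants_pi (p : ℕ) [Fact p.Prime] (n : ℕ) :
    Module.lengthAt (IwasawaAlgebra p) (coinvariants p (Fin n → IwasawaAlgebra p)) (primeT p) =
      n := by
  induction n with
  | zero =>
    haveI : Subsingleton (coinvariants p (Fin 0 → IwasawaAlgebra p)) := inferInstance
    rw [lengthAt_primeT_eq_zero_of_finite p (coinvariants p (Fin 0 → IwasawaAlgebra p))]
    rfl
  | succ n ih =>
    have e := coinvariantsEquiv
      (Fin.consLinearEquiv (IwasawaAlgebra p) (fun _ : Fin (n + 1) => IwasawaAlgebra p))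
    rw [← Module.lengthAt_eq_of_linearEquiv e (primeT p), lengthAt_coinvariants_prod,
      lengthAt_coinvariants_self, ih, add_comm]
    norm_cast

/-- **`ℓ_𝔭(Y_Γ) ≤ rank_Λ Y` for a finitely generated torsion-free `Λ`-module `Y`** (`𝔭 = (T)`;
in fact equality holds).  `Λ_𝔭` is a discrete valuation ring, so `Y_𝔭` is free of rank
`ρ = rank_Λ Y`; numerators `y₁, …, y_ρ ∈ Y` of a `Λ_𝔭`-basis generate `L ⊆ Y` with `(Y/L)_𝔭 = 0`,
and right exactness of `Γ`-coinvariants along `Λ^ρ → Y → Y/L → 0` gives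
`ℓ_𝔭(Y_Γ) ≤ ℓ_𝔭((Λ^ρ)_Γ) + ℓ_𝔭(Y/L) = ρ`.  Washington §13.2 (structure theorem, free part);
Greenberg, LNM 1716, §1 p. 57. [folklore] -/
theorem lengthAt_coinvariants_le_finrank_of_isTorsionFree (p : ℕ) [Fact p.Prime] (Y : Type u)
    [AddCommGroup Y] [Module (IwasawaAlgebra p) Y] [Module.Finite (IwasawaAlgebra p) Y]
    [Module.IsTorsionFree (IwasawaAlgebra p) Y] :
    Module.lengthAt (IwasawaAlgebra p) (coinvariants p Y) (primeT p) ≤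
      (Module.finrank (IwasawaAlgebra p) Y : ℕ∞) := by
  classical
  -- `Λ_𝔭` is a principal ideal domain (a discrete valuation ring), `𝔭 = (T)`
  haveI : IsPrincipalIdealRing (Localization.AtPrime (primeT p).asIdeal) :=
    (Module.isPrincipalIdealRing_localization_of_eq_span (primeT p).asIdeal (primeT_asIdeal p)
      PowerSeries.X_ne_zero).1
  -- `Y_𝔭` is finitely generated and torsion-free over `Λ_𝔭`, hence free
  haveI : Module.Free (Localization.AtPrime (primeT p).asIdeal)
      (LocalizedModule (primeT p).asIdeal.primeCompl Y) :=
    Module.free_of_finite_type_torsion_free'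
  -- a `Λ_𝔭`-basis of `Y_𝔭` and numerators of its vectors
  let b := Module.finBasis (Localization.AtPrime (primeT p).asIdeal)
    (LocalizedModule (primeT p).asIdeal.primeCompl Y)
  have hb : ∀ i, ∃ (y : Y) (s : (primeT p).asIdeal.primeCompl), LocalizedModule.mk y s = b i :=
    fun i ↦ by
      induction b i using LocalizedModule.induction_on with
      | h y s => exact ⟨y, s, rfl⟩
  choose y s hys using hb
  -- the free module on the numerators: `φ : Λ^ρ → Y`, `L = range φ`
  let φ : (Fin (Module.finrank (Localization.AtPrime (primeT p).asIdeal)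
      (LocalizedModule (primeT p).asIdeal.primeCompl Y)) → IwasawaAlgebra p) →ₗ[IwasawaAlgebra p]
      Y := Fintype.linearCombination (IwasawaAlgebra p) y
  -- `L_𝔭 = Y_𝔭`
  have hLloc : (LinearMap.range φ).localized' (Localization.AtPrime (primeT p).asIdeal)
      (primeT p).asIdeal.primeCompl
      (LocalizedModule.mkLinearMap (primeT p).asIdeal.primeCompl Y) = ⊤ := by
    rw [Fintype.range_linearCombination, Submodule.localized'_span, ← Set.range_comp, eq_top_iff,
      ← b.span_eq, Submodule.span_le]
    rintro _ ⟨i, rfl⟩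
    rw [← hys i]
    have hmk : LocalizedModule.mk (y i) (s i) =
        Localization.mk 1 (s i) • LocalizedModule.mk (y i) 1 := by
      rw [LocalizedModule.mk_smul_mk, one_smul, mul_one]
    rw [hmk]
    exact Submodule.smul_mem _ _ (Submodule.subset_span ⟨i, rfl⟩)
  -- hence `(Y/L)_𝔭 = 0`
  have hQ : Module.lengthAt (IwasawaAlgebra p) (Y ⧸ LinearMap.range φ) (primeT p) = 0 := by
    have e := IsLocalizedModule.iso (primeT p).asIdeal.primeCompl
      ((LinearMap.range φ).toLocalizedQuotient' (Localization.AtPrime (primeT p).asIdeal)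
        (primeT p).asIdeal.primeCompl
        (LocalizedModule.mkLinearMap (primeT p).asIdeal.primeCompl Y))
    haveI : Subsingleton (LocalizedModule (primeT p).asIdeal.primeCompl Y ⧸
        (LinearMap.range φ).localized' (Localization.AtPrime (primeT p).asIdeal)
          (primeT p).asIdeal.primeCompl
          (LocalizedModule.mkLinearMap (primeT p).asIdeal.primeCompl Y)) := by
      rw [Submodule.Quotient.subsingleton_iff]
      exact hLloc
    haveI : Subsingleton (LocalizedModule (primeT p).asIdeal.primeCompl
        (Y ⧸ LinearMap.range φ)) := e.toEquiv.subsingleton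
    exact _root_.Module.length_eq_zero_iff.mpr ‹_›
  -- right exactness of `Γ`-coinvariants along `Λ^ρ → Y → Y/L → 0`
  have hex := exact_coinvariantsMap φ (LinearMap.range φ).mkQ (Submodule.mkQ_surjective _)
    (LinearMap.exact_map_mkQ_range φ)
  have h1 := Module.lengthAt_le_add_of_exact _ _ hex (primeT p)
  have h2 : Module.lengthAt (IwasawaAlgebra p) (coinvariants p (Y ⧸ LinearMap.range φ))
      (primeT p) = 0 := by
    refine nonpos_iff_eq_zero.mp ?_
    rw [← hQ]
    exact Module.lengthAt_quotient_le _ _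
  rw [lengthAt_coinvariants_pi, h2, add_zero] at h1
  -- `ρ = rank_Λ Y`
  have hp : (primeT p).asIdeal.primeCompl ≤ nonZeroDivisors (IwasawaAlgebra p) :=
    Ideal.primeCompl_le_nonZeroDivisors _
  have hnY : Module.finrank (Localization.AtPrime (primeT p).asIdeal)
      (LocalizedModule (primeT p).asIdeal.primeCompl Y) = Module.finrank (IwasawaAlgebra p) Y := by
    rw [← IsLocalizedModule.finrank_eq (primeT p).asIdeal.primeCompl
      (LocalizedModule.mkLinearMap (primeT p).asIdeal.primeCompl Y) hp]
    unfold Module.finrank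
    rw [IsLocalization.rank_eq (Localization.AtPrime (primeT p).asIdeal)
      (primeT p).asIdeal.primeCompl hp]
  rw [← hnY]
  exact h1

/-! ### T1: `rank_{ℤ_p} X/TX ≤ rank_Λ X + ord_T f` -/

/-- **T1 — `rank_{ℤ_p} X_Γ ≤ rank_Λ X + ord_{T=0} f` for `f ∈ char_Λ(X_tors)`.** Let `X` be a
finitely generated `Λ = ℤ_p⟦T⟧`-module, `X_t` its `Λ`-torsion submodule and
`f ∈ char_Λ(X_t)` (`Literature.NumberTheory.EllipticCurves.Module.charIdeal`).  Then
`rank_{ℤ_p}(X/TX) ≤ rank_Λ X + ord_T f` (`coinvariantsRank`, `Module.finrank`,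
`PowerSeries.order ∈ ℕ∞`, `= ⊤` for `f = 0`).  Proof: `rank_{ℤ_p} X/TX = ℓ_𝔭(X/TX)` at `𝔭 = (T)`;
`Γ`-coinvariants are right exact along `0 → X_t → X → X/X_t → 0`, so
`ℓ_𝔭(X/TX) ≤ ℓ_𝔭(X_t/TX_t) + ℓ_𝔭((X/X_t)_Γ)`; `ℓ_𝔭(X_t/TX_t) ≤ ℓ_𝔭(X_t) ≤ ord_T f`
(`lengthAt_primeT_le_order`) and `ℓ_𝔭((X/X_t)_Γ) ≤ rank_Λ (X/X_t) ≤ rank_Λ X`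
(`lengthAt_coinvariants_le_finrank_of_isTorsionFree`).  This is the `k = 1` term of the derived
height filtration count `e = ∑_k (dim S^{(k)} − ρ)`; in structure-theorem terms
`rank X/TX = ρ + #{j : (f_j) = (T)} ≤ ρ + ∑_{(f_j) = (T)} a_j` (Washington Thm 13.12; Greenberg,
LNM 1716, §1 p. 57, p. 65). [cite: GreenbergLNM1716, §1 p. 57 and p. 65] -/
theorem coinvariantsRank_le_finrank_add_order (p : ℕ) [Fact p.Prime] (X : Type u)
    [AddCommGroup X] [Module (IwasawaAlgebra p) X] [Module.Finite (IwasawaAlgebra p) X]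
    (f : IwasawaAlgebra p)
    (hf : f ∈ Module.charIdeal (IwasawaAlgebra p)
      ↥(Submodule.torsion (IwasawaAlgebra p) X)) :
    (coinvariantsRank p X : ℕ∞) ≤
      (Module.finrank (IwasawaAlgebra p) X : ℕ∞) + PowerSeries.order f := by
  -- `rank_{ℤ_p} X/TX = ℓ_𝔭(X/TX)`
  rw [← lengthAt_coinvariants_eq_coinvariantsRank p X]
  -- right exactness along `0 → X_t → X → X/X_t → 0`
  have hex := exact_coinvariantsMap (Submodule.torsion (IwasawaAlgebra p) X).subtype
    (Submodule.torsion (IwasawaAlgebra p) X).mkQ (Submodule.mkQ_surjective _)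
    (LinearMap.exact_subtype_mkQ _)
  refine (Module.lengthAt_le_add_of_exact _ _ hex (primeT p)).trans ?_
  rw [add_comm]
  refine add_le_add ?_ ?_
  · -- torsion-free part
    refine (lengthAt_coinvariants_le_finrank_of_isTorsionFree p
      (X ⧸ Submodule.torsion (IwasawaAlgebra p) X)).trans ?_
    exact_mod_cast Submodule.finrank_quotient_le _
  · -- torsion part
    refine (Module.lengthAt_quotient_le _ _).trans ?_
    exact lengthAt_primeT_le_order _ (Submodule.torsion_isTorsion) f hf

/-! ### T2: `rank E(K) − rank_Λ X ≤ ord_T f` -/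

/-- **T2 — the half-strength two-max inequality, `rank E(K) − rank_Λ X(E/K_∞) ≤ ord_{T=0} f`.**
For an elliptic curve `E/K` over a number field, ANY `ℤ_p`-extension `κ` with topological
generator `γ`, any Pontryagin-dual datum `D` of `Sel_{p^∞}(E/K_∞)` with `X = D.X` finitely
generated over `Λ`, and every `f ∈ char_Λ(X_tors)`:
`rank E(K) − rank_Λ X ≤ ord_T f` (truncated subtraction in `ℕ`, `ord_T 0 = ⊤`).  From
`rank E(K) ≤ rank_{ℤ_p} X/TX` (`WeierstrassCurve.mordellWeilRank_le_coinvariantsRank`: Greenberg,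
LNM 1716, §3 Lemma 3.1 and §1 p. 65 — Kummer classes evaluated on the dual) and T1.  The factor
`2` and the `max` of the registered K2 need derived `p`-adic heights (Howard 2004 Thm 5.2) and are
NOT proved here. [cite: GreenbergLNM1716, §3 Lemma 3.1 and §1 p. 65] -/
theorem mordellWeilRank_sub_finrank_le_order {K : Type u} [Field K] [NumberField K]
    (W : WeierstrassCurve K) [W.IsElliptic] {p : ℕ} [Fact p.Prime] {κ : ZpExtension K p}
    {γ : Field.absoluteGaloisGroup K} (hγ : κ.IsTopGenerator γ) (D : W.SelmerDualData κ γ)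
    [Module.Finite (IwasawaAlgebra p) D.X] {f : IwasawaAlgebra p}
    (hf : f ∈ Module.charIdeal (IwasawaAlgebra p)
      ↥(Submodule.torsion (IwasawaAlgebra p) D.X)) :
    ((W.mordellWeilRank - Module.finrank (IwasawaAlgebra p) D.X : ℕ) : ℕ∞) ≤
      PowerSeries.order f := by
  have h1 := W.mordellWeilRank_le_coinvariantsRank hγ D
  have h2 := coinvariantsRank_le_finrank_add_order p D.X f hf
  generalize PowerSeries.order f = o at h2 ⊢
  induction o using ENat.recTopCoe with
  | top => exact le_top
  | coe k =>
    have h3 : coinvariantsRank p D.X ≤ Module.finrank (IwasawaAlgebra p) D.X + k := by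
      exact_mod_cast h2
    exact_mod_cast (show W.mordellWeilRank - Module.finrank (IwasawaAlgebra p) D.X ≤ k by omega)

/-! ### T3: the K2-shaped specialisation over `K/F` -/

/-- **The Mordell–Weil rank grows under base change**: for number fields `F → K` and `V/F`
elliptic, `rank V(F) ≤ rank V(K)` (`V(F) → V(K)` is injective, Mathlib
`WeierstrassCurve.Affine.Point.map_injective`; `V(K)` is finitely generated by the Mordell–Weil
theorem `WeierstrassCurve.module_finite_point_holds`). [folklore] -/
theorem mordellWeilRank_le_mordellWeilRank_baseChange {F : Type u} [Field F] [NumberField F]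
    (V : WeierstrassCurve F) [V.IsElliptic] (K : Type v) [Field K] [NumberField K] [Algebra F K] :
    V.mordellWeilRank ≤ (V.baseChange K).mordellWeilRank := by
  classical
  haveI : (V.baseChange K).IsElliptic := inferInstanceAs (V.map (algebraMap F K)).IsElliptic
  haveI : Module.Finite ℤ (V.baseChange K).toAffine.Point :=
    (V.baseChange K).module_finite_point_holds
  exact LinearMap.finrank_le_finrank_of_injective
    (f := (WeierstrassCurve.Affine.Point.map (W' := V.toAffine) (Algebra.ofId F K)).toIntLinearMap)
    (WeierstrassCurve.Affine.Point.map_injective (W' := V.toAffine) (Algebra.ofId F K))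

/-- **T3 — half-strength K2 in the shape of the registered stub.** For `V/F` elliptic over a
number field, a finite extension `K/F`, ANY `ℤ_p`-extension `κ` of `K` with topological generator
`γ`, any finitely generated dual datum `D` of `Sel_{p^∞}(V_K/K_∞)` and `f ∈ char_Λ((D.X)_tors)`:
with `r⁺ = rank V(F)`, `r⁻ = rank V(K) − rank V(F)`,
`max(r⁺, r⁻) − rank_Λ D.X ≤ ord_T f`.  Indeed `max(r⁺, r⁻) ≤ rank V(K)`
(`mordellWeilRank_le_mordellWeilRank_baseChange`) and `rank V(K) − rank_Λ D.X ≤ ord_T f` (T2).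
The registered K2 (`2 · (max(r⁺,r⁻) − ρ) ≤ ord_T f + δ`, anticyclotomic, derived heights) is
exactly twice this bound up to the trivial-zero count `δ`; the factor `2` is not proved here.
[cite: GreenbergLNM1716, §3 Lemma 3.1 and §1 p. 65] -/
theorem max_mordellWeilRank_sub_finrank_le_order {F : Type u} [Field F] [NumberField F]
    {K : Type v} [Field K] [NumberField K] [Algebra F K] (V : WeierstrassCurve F) [V.IsElliptic]
    {p : ℕ} [Fact p.Prime] {κ : ZpExtension K p} {γ : Field.absoluteGaloisGroup K}
    (hγ : κ.IsTopGenerator γ) (D : (V.baseChange K).SelmerDualData κ γ)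
    [Module.Finite (IwasawaAlgebra p) D.X] {f : IwasawaAlgebra p}
    (hf : f ∈ Module.charIdeal (IwasawaAlgebra p)
      ↥(Submodule.torsion (IwasawaAlgebra p) D.X)) :
    ((max V.mordellWeilRank ((V.baseChange K).mordellWeilRank - V.mordellWeilRank) -
        Module.finrank (IwasawaAlgebra p) D.X : ℕ) : ℕ∞) ≤ PowerSeries.order f := by
  haveI : (V.baseChange K).IsElliptic := inferInstanceAs (V.map (algebraMap F K)).IsElliptic
  have hmono := mordellWeilRank_le_mordellWeilRank_baseChange V K
  have h2 := mordellWeilRank_sub_finrank_le_order (V.baseChange K) hγ D hf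
  refine le_trans ?_ h2
  exact_mod_cast Nat.sub_le_sub_right (max_le hmono (Nat.sub_le _ _)) _

/-- **Half-strength K2 in the binder shape of the registered stub** (`∀ f ∈ char(X_tors), f ≠ 0 →
… ≤ ord_T f + δ`, for an ARBITRARY shift `δ : ℕ`, e.g. the trivial-zero count of the line):
`max(r⁺, r⁻) − rank_Λ D.X ≤ ord_T f + δ`, from `max_mordellWeilRank_sub_finrank_le_order` and
`ord_T f ≤ ord_T f + δ`.  No anticyclotomicity, reduction or ramification hypothesis is used; the
registered K2 strengthens the left side by the factor `2` (derived heights, not proved here).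
[cite: GreenbergLNM1716, §3 Lemma 3.1 and §1 p. 65] -/
theorem max_mordellWeilRank_sub_finrank_le_order_add {F : Type u} [Field F] [NumberField F]
    {K : Type v} [Field K] [NumberField K] [Algebra F K] (V : WeierstrassCurve F) [V.IsElliptic]
    {p : ℕ} [Fact p.Prime] {κ : ZpExtension K p} {γ : Field.absoluteGaloisGroup K}
    (hγ : κ.IsTopGenerator γ) (D : (V.baseChange K).SelmerDualData κ γ)
    [Module.Finite (IwasawaAlgebra p) D.X] (δ : ℕ) :
    ∀ f ∈ Module.charIdeal (IwasawaAlgebra p) ↥(Submodule.torsion (IwasawaAlgebra p) D.X),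
      f ≠ 0 →
        ((max V.mordellWeilRank ((V.baseChange K).mordellWeilRank - V.mordellWeilRank) -
            Module.finrank (IwasawaAlgebra p) D.X : ℕ) : ℕ∞) ≤
          PowerSeries.order f + (δ : ℕ∞) :=
  fun _ hf _ ↦ (max_mordellWeilRank_sub_finrank_le_order V hγ D hf).trans le_self_add

/-- Stub **K2½ — the HALF-STRENGTH two-max inequality in the registered binder shape** (helper stub
of line `heegner-leading-form-plectic-certificate`, crux `PlecticRankUB`, registered by the lead so
that this file rides with `--supports`): for number fields `F → K`, `V/F` elliptic, any
`ℤ_p`-extension `κ` of `K` with topological generator `γ`, any finitely generated dual datum `D` of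
`Sel_{p^∞}(V_K/K_∞)` and any `f ∈ char_Λ((D.X)_tors)`:
`max(r⁺, r⁻) − rank_Λ D.X ≤ ord_T f` — the `k = 1` term of the derived-height filtration, with
factor `1` instead of K2's `2`, unconditional in the reduction type and in the line
(`max_mordellWeilRank_sub_finrank_le_order`). [cite: GreenbergLNM1716, §1 p. 65] -/
theorem stub_halfTwoMax :
    ∀ (F : Type) [Field F] [NumberField F] (K : Type) [Field K] [NumberField K] [Algebra F K]
      (V : WeierstrassCurve F) [V.IsElliptic] (p : ℕ) [Fact p.Prime]
      (κ : ZpExtension K p) (γ : Field.absoluteGaloisGroup K)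
      (D : (V.baseChange K).SelmerDualData κ γ) [Module.Finite (IwasawaAlgebra p) D.X],
      κ.IsTopGenerator γ →
      ∀ f ∈ Literature.NumberTheory.EllipticCurves.Module.charIdeal (IwasawaAlgebra p)
          ↥(Submodule.torsion (IwasawaAlgebra p) D.X),
        ((max V.mordellWeilRank ((V.baseChange K).mordellWeilRank - V.mordellWeilRank) -
            Module.finrank (IwasawaAlgebra p) D.X : ℕ) : ℕ∞) ≤ PowerSeries.order f := by
  intro F _ _ K _ _ _ V _ p _ κ γ D _ hγ f hf
  exact max_mordellWeilRank_sub_finrank_le_order V hγ D hf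

end Summit.BirchSwinnertonDyer.BirchSwinnertonDyer.Theorems

end
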